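import Mathlib

/-!
# Crux `SignCone.ConeMagnification` (stmt-RiemannHypothesis-16303), line `Sketch` r8, stub `stub_designOfTypes`:
# the three single-prime blocks of the second-order design algebra

Seat-0 programme for the open core `stub_designOfTypes` (see `SignConeConeMagnificationDesignGcdForm.lean` for the
factorisation of the gcd form of a block design into single-prime `3 × 3` forms

  `B_p(g; v) = Σ_{i,j<3} g(i) conj(g(j)) p^{min(i, j+v)} / √(p^i p^j)`,   `v = v_p(n)`).

This file evaluates `B_p` in closed form for the three blocks the programme uses:

* (F) FIRST-ORDER block `g = (1 − x, √p·x, 0)`, `x` real:  `B(0) = 1 + (p−1)x²`, `B(v ≥ 1) = 1 + (p−1)x`;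
* (E) EXCLUDER block `g = (0, −√p, p)`:  `B(0) = p(p−1)`, `B(v ≥ 1) = 0`  (the factor `p(p−1)·[p ∤ n]`);
* (K) SQUAREFREE-KILLER block `g = (−t ω̄, √p (t ω̄ − 1), p)`, `t` real, `|ω| = 1`:
  `B(0) = (p−1)(t² + p)`, `B(1) = p(p−1)·t·ω`, `B(v ≥ 2) = 0`  (normalised: `[1 ; p t ω/(t²+p) ; 0]`, the freely
  rotatable Riesz–Euler profile factor of modulus up to `√p/2`),

and the achievability facts for the first-order ratio `r(x) = (p−1)(x − x²)/(1 + (p−1)x²)`: it is continuous,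
`r(1/(√p+1)) = (√p−1)/2`, `r(1/(1−√p)) = −(√p+1)/2`, hence (IVT) every value in `[−(√p+1)/2, (√p−1)/2]` is attained —
in particular `1/5` and `±(√p−1)/2` for every prime `p`; and `t ↦ p t/(t²+p)` attains every value in `[0, √p/2]` on `[0, √p]`.
-/

noncomputable section

-- `Summit.RiemannHypothesis.RiemannHypothesis.…` repeats a namespace component by design (D-0017 layout).
set_option linter.dupNamespace false

open Finset
open scoped BigOperators ComplexConjugate

namespace Summit.RiemannHypothesis.RiemannHypothesis.Theorems.SignConeConeMagnification

namespace Design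

/-! ### Square roots of prime powers -/

/-- `√(p^i · p^j) = (√p)^{i+j}` for `p ≥ 0`. [folklore] -/
theorem sqrt_pow_mul_pow {p : ℝ} (hp : 0 ≤ p) (i j : ℕ) :
    Real.sqrt (p ^ i * p ^ j) = Real.sqrt p ^ (i + j) := by
  have h : p ^ i * p ^ j = (Real.sqrt p ^ (i + j)) ^ 2 := by
    rw [← pow_mul, mul_comm (i + j) 2, pow_mul, Real.sq_sqrt hp, pow_add]
  rw [h, Real.sqrt_sq (pow_nonneg (Real.sqrt_nonneg _) _)]

/-- `(√p)² = p` in `ℂ`. [folklore] -/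
theorem sqrt_natCast_sq (p : ℕ) : ((Real.sqrt p : ℝ) : ℂ) ^ 2 = (p : ℂ) := by
  rw [← Complex.ofReal_pow, Real.sq_sqrt (Nat.cast_nonneg _), Complex.ofReal_natCast]

/-- The single-prime form with the square roots written as powers of `√p`. [folklore] -/
theorem blockForm_eq_sqrt_pow (p : ℕ) (g : ℕ → ℂ) (v : ℕ) :
    (∑ i ∈ Finset.range 3, ∑ j ∈ Finset.range 3, g i * (starRingEnd ℂ) (g j) *
        ((p : ℂ) ^ min i (j + v) / (Real.sqrt ((p : ℝ) ^ i * (p : ℝ) ^ j) : ℂ))) =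
      ∑ i ∈ Finset.range 3, ∑ j ∈ Finset.range 3, g i * (starRingEnd ℂ) (g j) *
        ((((Real.sqrt p : ℝ) : ℂ) ^ 2) ^ min i (j + v) / ((Real.sqrt p : ℝ) : ℂ) ^ (i + j)) := by
  refine Finset.sum_congr rfl fun i _ => Finset.sum_congr rfl fun j _ => ?_
  rw [sqrt_pow_mul_pow (Nat.cast_nonneg p), sqrt_natCast_sq]
  push_cast
  rfl

/-! ### (E) The excluder block `(0, −√p, p)` -/

/-- **Excluder block**, coprime case: `B_p((0,−√p,p); 0) = p(p−1)`. [folklore] -/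
theorem blockForm_excluder_zero (p : ℕ) (hp : p.Prime) (g : ℕ → ℂ) (hg0 : g 0 = 0)
    (hg1 : g 1 = -((Real.sqrt p : ℝ) : ℂ)) (hg2 : g 2 = (p : ℂ)) :
    (∑ i ∈ Finset.range 3, ∑ j ∈ Finset.range 3, g i * (starRingEnd ℂ) (g j) *
        ((p : ℂ) ^ min i (j + 0) / (Real.sqrt ((p : ℝ) ^ i * (p : ℝ) ^ j) : ℂ))) =
      (p : ℂ) * ((p : ℂ) - 1) := by
  rw [blockForm_eq_sqrt_pow]
  have hs : ((Real.sqrt p : ℝ) : ℂ) ≠ 0 := by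
    exact_mod_cast (Real.sqrt_pos.2 (by exact_mod_cast hp.pos)).ne'
  rw [← sqrt_natCast_sq p] at hg2 ⊢
  simp only [Finset.sum_range_succ, Finset.sum_range_zero, zero_add, hg0, hg1, hg2, map_neg, map_pow,
    Complex.conj_ofReal, Nat.min_def]
  norm_num
  field_simp
  ring

/-- **Excluder block**, divisible case: `B_p((0,−√p,p); v) = 0` for `v ≥ 1`. [folklore] -/
theorem blockForm_excluder_pos (p : ℕ) (hp : p.Prime) (g : ℕ → ℂ) (hg0 : g 0 = 0)
    (hg1 : g 1 = -((Real.sqrt p : ℝ) : ℂ)) (hg2 : g 2 = (p : ℂ)) (v : ℕ) (hv : 1 ≤ v) :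
    (∑ i ∈ Finset.range 3, ∑ j ∈ Finset.range 3, g i * (starRingEnd ℂ) (g j) *
        ((p : ℂ) ^ min i (j + v) / (Real.sqrt ((p : ℝ) ^ i * (p : ℝ) ^ j) : ℂ))) = 0 := by
  rw [blockForm_eq_sqrt_pow]
  have hs : ((Real.sqrt p : ℝ) : ℂ) ≠ 0 := by
    exact_mod_cast (Real.sqrt_pos.2 (by exact_mod_cast hp.pos)).ne'
  rw [← sqrt_natCast_sq p] at hg2
  have hm1 : min 1 v = 1 := min_eq_left (by omega)
  have hm2 : min 1 (1 + v) = 1 := min_eq_left (by omega)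
  have hm3 : min 1 (2 + v) = 1 := min_eq_left (by omega)
  have hm4 : min 2 (1 + v) = 2 := min_eq_left (by omega)
  have hm5 : min 2 (2 + v) = 2 := min_eq_left (by omega)
  simp only [Finset.sum_range_succ, Finset.sum_range_zero, zero_add, hg0, hg1, hg2, map_neg, map_pow,
    Complex.conj_ofReal, hm1, hm2, hm3, hm4, hm5, Nat.zero_min]
  -- the term (i,j) = (2,0) carries `min 2 (0 + v)`, but `g 0 = 0` kills it
  norm_num
  field_simp
  ring

/-! ### (F) The first-order block `(1 − x, √p·x, 0)` -/

/-- **First-order block**, coprime case: `B_p((1−x, √p x, 0); 0) = 1 + (p−1)x²`. [folklore] -/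
theorem blockForm_first_zero (p : ℕ) (hp : p.Prime) (x : ℝ) (g : ℕ → ℂ) (hg0 : g 0 = ((1 - x : ℝ) : ℂ))
    (hg1 : g 1 = ((Real.sqrt p * x : ℝ) : ℂ)) (hg2 : g 2 = 0) :
    (∑ i ∈ Finset.range 3, ∑ j ∈ Finset.range 3, g i * (starRingEnd ℂ) (g j) *
        ((p : ℂ) ^ min i (j + 0) / (Real.sqrt ((p : ℝ) ^ i * (p : ℝ) ^ j) : ℂ))) =
      ((1 + (p - 1) * x ^ 2 : ℝ) : ℂ) := by
  rw [blockForm_eq_sqrt_pow]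
  have hs : ((Real.sqrt p : ℝ) : ℂ) ≠ 0 := by
    exact_mod_cast (Real.sqrt_pos.2 (by exact_mod_cast hp.pos)).ne'
  push_cast
  rw [← sqrt_natCast_sq p]
  push_cast at hg0 hg1
  simp only [Finset.sum_range_succ, Finset.sum_range_zero, zero_add, hg0, hg1, hg2, map_sub, map_one,
    map_mul, Complex.conj_ofReal, Nat.min_def]
  norm_num
  field_simp
  ring

/-- **First-order block**, divisible case: `B_p((1−x, √p x, 0); v) = 1 + (p−1)x` for `v ≥ 1`. [folklore] -/
theorem blockForm_first_pos (p : ℕ) (hp : p.Prime) (x : ℝ) (g : ℕ → ℂ) (hg0 : g 0 = ((1 - x : ℝ) : ℂ))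
    (hg1 : g 1 = ((Real.sqrt p * x : ℝ) : ℂ)) (hg2 : g 2 = 0) (v : ℕ) (hv : 1 ≤ v) :
    (∑ i ∈ Finset.range 3, ∑ j ∈ Finset.range 3, g i * (starRingEnd ℂ) (g j) *
        ((p : ℂ) ^ min i (j + v) / (Real.sqrt ((p : ℝ) ^ i * (p : ℝ) ^ j) : ℂ))) =
      ((1 + (p - 1) * x : ℝ) : ℂ) := by
  rw [blockForm_eq_sqrt_pow]
  have hs : ((Real.sqrt p : ℝ) : ℂ) ≠ 0 := by
    exact_mod_cast (Real.sqrt_pos.2 (by exact_mod_cast hp.pos)).ne'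
  push_cast
  rw [← sqrt_natCast_sq p]
  push_cast at hg0 hg1
  have hm0 : min 1 v = 1 := min_eq_left (by omega)
  have hm1 : min 1 (1 + v) = 1 := min_eq_left (by omega)
  have hm2 : min 1 (2 + v) = 1 := min_eq_left (by omega)
  simp only [Finset.sum_range_succ, Finset.sum_range_zero, zero_add, hg0, hg1, hg2, map_sub, map_one,
    map_mul, Complex.conj_ofReal, hm0, hm1, hm2, Nat.zero_min]
  norm_num
  field_simp
  ring

/-! ### (K) The squarefree-killer block `(−t ω̄, √p (t ω̄ − 1), p)` -/

/-- **Squarefree-killer block**, coprime case: `B_p(K(t,ω); 0) = (p−1)(t² + p)` (`|ω| = 1`). [folklore] -/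
theorem blockForm_killer_zero (p : ℕ) (hp : p.Prime) (t : ℝ) (ω : ℂ) (hω0 : ω ≠ 0)
    (hω : (starRingEnd ℂ) ω = ω⁻¹) (g : ℕ → ℂ) (hg0 : g 0 = -(t : ℂ) * (starRingEnd ℂ) ω)
    (hg1 : g 1 = ((Real.sqrt p : ℝ) : ℂ) * ((t : ℂ) * (starRingEnd ℂ) ω - 1)) (hg2 : g 2 = (p : ℂ)) :
    (∑ i ∈ Finset.range 3, ∑ j ∈ Finset.range 3, g i * (starRingEnd ℂ) (g j) *
        ((p : ℂ) ^ min i (j + 0) / (Real.sqrt ((p : ℝ) ^ i * (p : ℝ) ^ j) : ℂ))) =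
      ((p : ℂ) - 1) * ((t : ℂ) ^ 2 + p) := by
  rw [blockForm_eq_sqrt_pow]
  have hs : ((Real.sqrt p : ℝ) : ℂ) ≠ 0 := by
    exact_mod_cast (Real.sqrt_pos.2 (by exact_mod_cast hp.pos)).ne'
  rw [← sqrt_natCast_sq p] at hg2 ⊢
  rw [hω] at hg0 hg1
  simp only [Finset.sum_range_succ, Finset.sum_range_zero, zero_add, hg0, hg1, hg2, map_sub, map_one,
    map_mul, map_neg, map_inv₀, map_pow, Complex.conj_ofReal, hω, Nat.min_def]
  norm_num
  field_simp
  ring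

/-- **Squarefree-killer block**, exactly-divisible case: `B_p(K(t,ω); 1) = p(p−1)·t·ω` (`|ω| = 1`). [folklore] -/
theorem blockForm_killer_one (p : ℕ) (hp : p.Prime) (t : ℝ) (ω : ℂ) (hω0 : ω ≠ 0)
    (hω : (starRingEnd ℂ) ω = ω⁻¹) (g : ℕ → ℂ) (hg0 : g 0 = -(t : ℂ) * (starRingEnd ℂ) ω)
    (hg1 : g 1 = ((Real.sqrt p : ℝ) : ℂ) * ((t : ℂ) * (starRingEnd ℂ) ω - 1)) (hg2 : g 2 = (p : ℂ)) :
    (∑ i ∈ Finset.range 3, ∑ j ∈ Finset.range 3, g i * (starRingEnd ℂ) (g j) *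
        ((p : ℂ) ^ min i (j + 1) / (Real.sqrt ((p : ℝ) ^ i * (p : ℝ) ^ j) : ℂ))) =
      (p : ℂ) * ((p : ℂ) - 1) * t * ω := by
  rw [blockForm_eq_sqrt_pow]
  have hs : ((Real.sqrt p : ℝ) : ℂ) ≠ 0 := by
    exact_mod_cast (Real.sqrt_pos.2 (by exact_mod_cast hp.pos)).ne'
  rw [← sqrt_natCast_sq p] at hg2 ⊢
  rw [hω] at hg0 hg1
  simp only [Finset.sum_range_succ, Finset.sum_range_zero, zero_add, hg0, hg1, hg2, map_sub, map_one,
    map_mul, map_neg, map_inv₀, map_pow, Complex.conj_ofReal, hω, Nat.min_def]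
  norm_num
  field_simp
  ring

/-- **Squarefree-killer block**, square-divisible case: `B_p(K(t,ω); v) = 0` for `v ≥ 2`. [folklore] -/
theorem blockForm_killer_two (p : ℕ) (hp : p.Prime) (t : ℝ) (ω : ℂ) (hω0 : ω ≠ 0)
    (hω : (starRingEnd ℂ) ω = ω⁻¹) (g : ℕ → ℂ) (hg0 : g 0 = -(t : ℂ) * (starRingEnd ℂ) ω)
    (hg1 : g 1 = ((Real.sqrt p : ℝ) : ℂ) * ((t : ℂ) * (starRingEnd ℂ) ω - 1)) (hg2 : g 2 = (p : ℂ))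
    (v : ℕ) (hv : 2 ≤ v) :
    (∑ i ∈ Finset.range 3, ∑ j ∈ Finset.range 3, g i * (starRingEnd ℂ) (g j) *
        ((p : ℂ) ^ min i (j + v) / (Real.sqrt ((p : ℝ) ^ i * (p : ℝ) ^ j) : ℂ))) = 0 := by
  rw [blockForm_eq_sqrt_pow]
  have hs : ((Real.sqrt p : ℝ) : ℂ) ≠ 0 := by
    exact_mod_cast (Real.sqrt_pos.2 (by exact_mod_cast hp.pos)).ne'
  rw [← sqrt_natCast_sq p] at hg2
  rw [hω] at hg0 hg1
  have hm0 : min 1 v = 1 := min_eq_left (by omega)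
  have hm1 : min 1 (1 + v) = 1 := min_eq_left (by omega)
  have hm2 : min 1 (2 + v) = 1 := min_eq_left (by omega)
  have hm3 : min 2 v = 2 := min_eq_left (by omega)
  have hm4 : min 2 (1 + v) = 2 := min_eq_left (by omega)
  have hm5 : min 2 (2 + v) = 2 := min_eq_left (by omega)
  simp only [Finset.sum_range_succ, Finset.sum_range_zero, zero_add, hg0, hg1, hg2, map_sub, map_one,
    map_mul, map_neg, map_inv₀, map_pow, Complex.conj_ofReal, hω, hm0, hm1, hm2,
    hm3, hm4, hm5, Nat.zero_min]
  norm_num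
  field_simp
  ring

/-! ### Achievability of the block parameters -/

/-- The first-order ratio `ρ(x) = (1 + (p−1)x)/(1 + (p−1)x²)` is continuous. [folklore] -/
theorem continuous_firstRatio (p : ℕ) (hp : p.Prime) :
    Continuous fun x : ℝ => (1 + ((p : ℝ) - 1) * x) / (1 + ((p : ℝ) - 1) * x ^ 2) := by
  have hp1 : (1 : ℝ) ≤ p := by exact_mod_cast hp.one_lt.le
  apply Continuous.div (by fun_prop) (by fun_prop)
  intro x
  have : 0 ≤ ((p : ℝ) - 1) * x ^ 2 := mul_nonneg (by linarith) (sq_nonneg x)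
  linarith

/-- `ρ(1/(√p+1)) = 1 + (√p−1)/2` (the maximum of the first-order ratio). [folklore] -/
theorem firstRatio_at_max (p : ℕ) (hp : p.Prime) :
    (1 + ((p : ℝ) - 1) * (1 / (Real.sqrt p + 1))) / (1 + ((p : ℝ) - 1) * (1 / (Real.sqrt p + 1)) ^ 2) =
      1 + (Real.sqrt p - 1) / 2 := by
  obtain ⟨s, hs0, hsp⟩ : ∃ s : ℝ, 0 < s ∧ Real.sqrt p = s :=
    ⟨_, Real.sqrt_pos.2 (by exact_mod_cast hp.pos), rfl⟩
  have hsq : (p : ℝ) = s ^ 2 := by rw [← hsp, Real.sq_sqrt (Nat.cast_nonneg _)]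
  rw [hsp, hsq]
  have h1 : s + 1 ≠ 0 := by positivity
  have h2 : s ≠ 0 := hs0.ne'
  have e1 : 1 + (s ^ 2 - 1) * (1 / (s + 1)) = s := by field_simp; ring
  have e2 : 1 + (s ^ 2 - 1) * (1 / (s + 1)) ^ 2 = 2 * s / (s + 1) := by field_simp; ring
  rw [e1, e2, div_div_eq_mul_div]
  field_simp
  ring

/-- `ρ(1/(1−√p)) = 1 − (√p+1)/2` (the minimum of the first-order ratio). [folklore] -/
theorem firstRatio_at_min (p : ℕ) (hp : p.Prime) :
    (1 + ((p : ℝ) - 1) * (1 / (1 - Real.sqrt p))) / (1 + ((p : ℝ) - 1) * (1 / (1 - Real.sqrt p)) ^ 2) =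
      1 - (Real.sqrt p + 1) / 2 := by
  have hs1 : 1 < Real.sqrt p := by
    rw [show (1 : ℝ) = Real.sqrt 1 from Real.sqrt_one.symm]
    exact Real.sqrt_lt_sqrt zero_le_one (by exact_mod_cast hp.one_lt)
  obtain ⟨s, hs0, hsp⟩ : ∃ s : ℝ, 1 < s ∧ Real.sqrt p = s := ⟨_, hs1, rfl⟩
  have hsq : (p : ℝ) = s ^ 2 := by rw [← hsp, Real.sq_sqrt (Nat.cast_nonneg _)]
  rw [hsp, hsq]
  have h1 : 1 - s ≠ 0 := by linarith
  have h2 : s - 1 ≠ 0 := by linarith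
  have h3 : s ≠ 0 := by linarith
  have e1 : 1 + (s ^ 2 - 1) * (1 / (1 - s)) = -s := by field_simp; ring
  have e2 : 1 + (s ^ 2 - 1) * (1 / (1 - s)) ^ 2 = 2 * s / (s - 1) := by field_simp; ring
  rw [e1, e2, div_div_eq_mul_div]
  field_simp
  ring

/-- **Achievability of first-order ratios**: every `ρ ∈ [1 − (√p+1)/2, 1 + (√p−1)/2]` is `ρ(x)` for some real `x`
(IVT between the two extremal points). [folklore] -/
theorem exists_firstRatio_eq (p : ℕ) (hp : p.Prime) (ρ : ℝ) (hlo : 1 - (Real.sqrt p + 1) / 2 ≤ ρ)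
    (hhi : ρ ≤ 1 + (Real.sqrt p - 1) / 2) :
    ∃ x : ℝ, (1 + ((p : ℝ) - 1) * x) / (1 + ((p : ℝ) - 1) * x ^ 2) = ρ := by
  have hs1 : 1 < Real.sqrt p := by
    rw [show (1 : ℝ) = Real.sqrt 1 from Real.sqrt_one.symm]
    exact Real.sqrt_lt_sqrt zero_le_one (by exact_mod_cast hp.one_lt)
  set a : ℝ := 1 / (1 - Real.sqrt p) with ha
  set b : ℝ := 1 / (Real.sqrt p + 1) with hb
  have hab : a ≤ b := by
    have ha0 : a < 0 := by rw [ha]; exact div_neg_of_pos_of_neg one_pos (by linarith)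
    have hb0 : 0 < b := by rw [hb]; positivity
    linarith
  have hcont := (continuous_firstRatio p hp).continuousOn (s := Set.Icc a b)
  have hmem : ρ ∈ Set.Icc ((fun x : ℝ => (1 + ((p : ℝ) - 1) * x) / (1 + ((p : ℝ) - 1) * x ^ 2)) a)
      ((fun x : ℝ => (1 + ((p : ℝ) - 1) * x) / (1 + ((p : ℝ) - 1) * x ^ 2)) b) := by
    simp only [ha, hb]
    rw [firstRatio_at_min p hp, firstRatio_at_max p hp]
    exact ⟨hlo, hhi⟩
  obtain ⟨x, -, hx⟩ := intermediate_value_Icc hab hcont hmem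
  exact ⟨x, hx⟩

/-- Every prime admits a first-order block with ratio exactly `6/5` (needs only `(√2−1)/2 ≥ 1/5`). [folklore] -/
theorem exists_firstRatio_eq_six_fifths (p : ℕ) (hp : p.Prime) :
    ∃ x : ℝ, (1 + ((p : ℝ) - 1) * x) / (1 + ((p : ℝ) - 1) * x ^ 2) = 6 / 5 := by
  apply exists_firstRatio_eq p hp
  · have : 0 ≤ Real.sqrt p := Real.sqrt_nonneg _
    linarith
  · -- `√p ≥ √2 > 7/5`
    have h2 : (7 / 5 : ℝ) ≤ Real.sqrt p := by
      rw [show (7 / 5 : ℝ) = Real.sqrt ((7 / 5) ^ 2) by rw [Real.sqrt_sq]; norm_num]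
      apply Real.sqrt_le_sqrt
      have : (2 : ℝ) ≤ p := by exact_mod_cast hp.two_le
      nlinarith
    linarith

/-- Every prime admits first-order blocks with ratios `1 ± (√p−1)/2`. [folklore] -/
theorem exists_firstRatio_eq_pm_tau (p : ℕ) (hp : p.Prime) (ε : ℝ) (hε : ε = 1 ∨ ε = -1) :
    ∃ x : ℝ, (1 + ((p : ℝ) - 1) * x) / (1 + ((p : ℝ) - 1) * x ^ 2) = 1 + ε * ((Real.sqrt p - 1) / 2) := by
  have hs1 : 1 ≤ Real.sqrt p := by
    rw [show (1 : ℝ) = Real.sqrt 1 from Real.sqrt_one.symm]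
    exact Real.sqrt_le_sqrt (by exact_mod_cast hp.one_lt.le)
  apply exists_firstRatio_eq p hp
  · rcases hε with h | h <;> subst h <;> nlinarith
  · rcases hε with h | h <;> subst h <;> nlinarith

/-- **Achievability of killer moduli**: every `m ∈ [0, √p/2]` is `p t/(t²+p)` for some `t ∈ [0, √p]`. [folklore] -/
theorem exists_killerRatio_eq (p : ℕ) (hp : p.Prime) (m : ℝ) (hm0 : 0 ≤ m) (hm : m ≤ Real.sqrt p / 2) :
    ∃ t : ℝ, 0 ≤ t ∧ (p : ℝ) * t / (t ^ 2 + p) = m := by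
  have hp0 : (0 : ℝ) < p := by exact_mod_cast hp.pos
  have hcont : ContinuousOn (fun t : ℝ => (p : ℝ) * t / (t ^ 2 + p)) (Set.Icc 0 (Real.sqrt p)) := by
    apply Continuous.continuousOn
    apply Continuous.div (by fun_prop) (by fun_prop)
    intro t
    positivity
  have h0 : (fun t : ℝ => (p : ℝ) * t / (t ^ 2 + p)) 0 = 0 := by simp
  have h1 : (fun t : ℝ => (p : ℝ) * t / (t ^ 2 + p)) (Real.sqrt p) = Real.sqrt p / 2 := by
    simp only
    rw [Real.sq_sqrt hp0.le]
    field_simp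
    ring
  have hmem : m ∈ Set.Icc ((fun t : ℝ => (p : ℝ) * t / (t ^ 2 + p)) 0)
      ((fun t : ℝ => (p : ℝ) * t / (t ^ 2 + p)) (Real.sqrt p)) := by
    rw [h0, h1]; exact ⟨hm0, hm⟩
  obtain ⟨t, ht, htm⟩ := intermediate_value_Icc (Real.sqrt_nonneg _) hcont hmem
  exact ⟨t, ht.1, htm⟩

/-- **Registered sub-goal `designBlocks`** (seat-0 anchor of this file, design algebra §1 of the proof of
`stub_designOfTypes`): the squarefree-killer block `K(t, ω) = (−t ω̄, √p (t ω̄ − 1), p)` has single-prime forms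
`(p−1)(t²+p)`, `p(p−1) t ω`, `0` at `v_p(n) = 0, 1, ≥ 2` — the freely rotatable Riesz–Euler profile factor. [folklore] -/
theorem designBlocks : ∀ p : ℕ, p.Prime → ∀ t : ℝ, ∀ ω : ℂ, ω ≠ 0 → (starRingEnd ℂ) ω = ω⁻¹ →
    ∀ g : ℕ → ℂ, g 0 = -(t : ℂ) * (starRingEnd ℂ) ω →
    g 1 = ((Real.sqrt p : ℝ) : ℂ) * ((t : ℂ) * (starRingEnd ℂ) ω - 1) → g 2 = (p : ℂ) →
    (∑ i ∈ Finset.range 3, ∑ j ∈ Finset.range 3, g i * (starRingEnd ℂ) (g j) *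
        ((p : ℂ) ^ min i (j + 0) / (Real.sqrt ((p : ℝ) ^ i * (p : ℝ) ^ j) : ℂ))) =
      ((p : ℂ) - 1) * ((t : ℂ) ^ 2 + p) ∧
    (∑ i ∈ Finset.range 3, ∑ j ∈ Finset.range 3, g i * (starRingEnd ℂ) (g j) *
        ((p : ℂ) ^ min i (j + 1) / (Real.sqrt ((p : ℝ) ^ i * (p : ℝ) ^ j) : ℂ))) =
      (p : ℂ) * ((p : ℂ) - 1) * t * ω ∧
    (∀ v : ℕ, 2 ≤ v →
      (∑ i ∈ Finset.range 3, ∑ j ∈ Finset.range 3, g i * (starRingEnd ℂ) (g j) *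
        ((p : ℂ) ^ min i (j + v) / (Real.sqrt ((p : ℝ) ^ i * (p : ℝ) ^ j) : ℂ))) = 0) :=
  fun p hp t ω hω0 hω g hg0 hg1 hg2 =>
    ⟨blockForm_killer_zero p hp t ω hω0 hω g hg0 hg1 hg2, blockForm_killer_one p hp t ω hω0 hω g hg0 hg1 hg2,
      fun v hv => blockForm_killer_two p hp t ω hω0 hω g hg0 hg1 hg2 v hv⟩

end Design

end Summit.RiemannHypothesis.RiemannHypothesis.Theorems.SignConeConeMagnification
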